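import Summits.HodgeConjecture.HodgeConjecture.Theorems.HeckePrymWeilWeilTenfoldsSqrtMinus11TensorSquare
import Literature.AlgebraicGeometry.Motives.AimedSplitProductDischarge
import Literature.AlgebraicGeometry.Motives.AimedSplitProductCounterexampleClass
import Literature.AlgebraicGeometry.HodgeTheory.AlgebraicClassesHodgeTypeHolds
import Literature.AlgebraicGeometry.HodgeTheory.WeilClassesRationalPlane
import Literature.AlgebraicGeometry.HodgeTheory.WeilClassesIsogenyDescent
import HarnessLib

/-!
# The tensor LOCUS of crux `HeckePrymWeil.WeilTenfoldsSqrtMinus11` (stmt-HodgeConjecture-1262): the crux on every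
# tenfold `K`-isogenous to a tensor square, and a split `ℚ(√-11)` TWELVEFOLD in the route typing EXISTS

Route `HeckePrymWeil`, line `generic-ppav-secant-descent` (lead c4, 2026-08-17), registered sub-goal
`stub_splitTwelvefoldAnchorExists`: there EXIST a complex abelian twelvefold `A₀`, `ψ₀ ≫ ψ₀ = -11`, a projective
embedding `e₀` and a rational `a₀ ≠ 0` with `(A₀, ψ₀)` of HYPERBOLIC Weil type in half-dimension `6` for the
`K`-symmetrised hyperplane class `11·e₀^*a₀ + ψ₀^*e₀^*a₀` — verbatim the first five conjuncts of the `∃`-block of the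
bet `stub_secantSpreadEmbedded` (the Disproof's caveat F2/§D of cycle 3, "the cohomological half of the anchor is not
constructible", is thereby retired: the typing block of the bet is satisfiable in the tree; only the SPREADING is open).

Witness: `A₀ = (X × X) × B` for ANY abelian fivefold `X` (they exist, `exists_abelianVariety_dim_eq_succ`) with the
tensor-square `√-11`, `ψ_T = ⟨pr₂ ≫ (-11), pr₁⟩`, and the CM Weil surface `(B, ψ_B)` of the discharged aiming fact
`Motives.exists_cmWeilSurface_aimedSplitProduct_of_ne_one_of_ne_three_holds` at `d = 11`, `n = 5`: its hypothesis — a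
non-zero RATIONAL `(5,5)` class in the typed Weil plane of `(X × X, ψ_T)` — is supplied by the tensor-square theorem
(`stub_tensorSquareWeilClassesAlgebraic`, p164120: the whole Weil plane of the tensor square is ALGEBRAIC, hence of
Hodge type `(5,5)` by `isOfHodgeType_of_mem_algebraicClasses_of_isSmoothProjective`) together with
`exists_isRationalClass_ne_zero_mem_weilClassesOf` and `weilClassesOf_le_eigenspace_sup_eigenspace`.

Second registered sub-goal `stub_tensorIsogenousCrux`: the crux in its literal typing on every `√-11` tenfold `(A, φ)`
that is `K`-ISOGENOUS to a tensor square (`u : A ⟶ X × X` flat, `v` back, `u ≫ v = m·𝟙`, `v ≫ φ = ψ_T ≫ v`) — the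
whole tensor locus `{X × X̂}` of the split component up to isogeny (e.g. `X × X̂` for a non-principal polarization):
the proved isogeny descent `mem_algebraicClasses_of_isogeny_of_mem_weilClassesOf` over the tensor-square theorem.
-/

noncomputable section

-- single-problem summit (Problem = Summit): the mandated namespace repeats `HodgeConjecture`.
set_option linter.dupNamespace false

open CategoryTheory
open Literature.AlgebraicGeometry Literature.AlgebraicGeometry.Motives
  Literature.AlgebraicGeometry.HodgeTheory
open Literature.AlgebraicTopology.SingularHomology

namespace Summit.HodgeConjecture.HodgeConjecture.Theorems.WeilTenfoldsSqrtMinus11.TensorSquare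

/-- **A split `√-11` twelvefold in the route typing exists** (registered sub-goal `stub_splitTwelvefoldAnchorExists`,
verbatim the anchor block of `stub_secantSpreadEmbedded`): `A₀ = (X₅ × X₅) × B` with `ψ₀ = ψ_T × ψ_B`, the aiming fact
fed with a non-zero rational `(5,5)` Weil class of the tensor square (module docstring).
[cite: Markman2025SurveySecant, §11.5 Step 2] [cite: vanGeemen1994HodgeAV, Lemma 5.2 (2)–(3) and 5.4] -/
theorem stub_splitTwelvefoldAnchorExists :
    ∃ (A₀ : AbelianVariety ℂ) (ψ₀ : A₀ ⟶ A₀) (e₀ : ProjectiveEmbedding A₀.X)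
      (a₀ : complexBetti (projectiveSpace e₀.n ℂ) 2),
      A₀.dim = 12 ∧ ψ₀ ≫ ψ₀ = -((11 : ℤ) • 𝟙 A₀) ∧ IsRationalClass a₀ ∧ a₀ ≠ 0 ∧
      IsHyperbolicWeilType A₀ ψ₀ 6
        ((11 : ℂ) • complexBetti.map e₀.ι 2 a₀ +
          complexBetti.map ψ₀.hom.hom.hom 2 (complexBetti.map e₀.ι 2 a₀)) := by
  -- an abelian fivefold and its tensor square
  obtain ⟨X, hX⟩ := exists_abelianVariety_dim_eq_succ ℂ 4
  set ψT : X.prod X ⟶ X.prod X :=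
    AbelianVariety.prodLift (AbelianVariety.snd X X ≫ ((-(11 : ℤ)) • 𝟙 X)) (AbelianVariety.fst X X) with hψTdef
  have hT : (X.prod X).dim = 2 * 5 := by rw [AbelianVariety.dim_prod, hX]
  have hψTℕ : ψT ≫ ψT = -((11 : ℕ) • 𝟙 (X.prod X)) := by
    rw [hψTdef, offDiagonal_comp_self, neg_smul]; rfl
  have hψTℤ : ψT ≫ ψT = -(((11 : ℕ) : ℤ) • 𝟙 (X.prod X)) := by
    rw [hψTdef, offDiagonal_comp_self, neg_smul]; rfl
  -- a non-zero rational Weil class of the tensor square; it is ALGEBRAIC, hence of type `(5,5)`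
  obtain ⟨c, hcW, hc0, hcr⟩ :=
    exists_isRationalClass_ne_zero_mem_weilClassesOf (n := 5) (d := 11) (by norm_num) hT (by norm_num) hψTℕ
  have hcalg : c ∈ algebraicClasses (X.prod X).X 5 :=
    stub_tensorSquareWeilClassesAlgebraic 5 11 (by norm_num) (by norm_num) X hX hcW
  have hTsp : IsSmoothProjective (2 * 5) (X.prod X).X := isSmoothProjective_of_dim_eq' hT
  have hcH : IsOfHodgeType (2 * 5) (X.prod X).X (2 * 5) 5 5 c :=
    isOfHodgeType_of_mem_algebraicClasses_of_isSmoothProjective hTsp 5 hcalg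
  have hcE := weilClassesOf_le_eigenspace_sup_eigenspace ψT 5 11 hcW
  -- the aiming fact at `d = 11`, `n = 5`
  obtain ⟨B, ψB, hB, hψB, -, haim⟩ :=
    exists_cmWeilSurface_aimedSplitProduct_of_ne_one_of_ne_three_holds 11 (by norm_num) (by norm_num) (by norm_num)
  obtain ⟨e, a, ha, ha0, hhyp⟩ := haim 5 (X.prod X) ψT hT hψTℤ ⟨c, hc0, hcr, hcH, hcE⟩
  have hψBℕ : ψB ≫ ψB = -((11 : ℕ) • 𝟙 B) := by rw [hψB]; rfl
  refine ⟨(X.prod X).prod B,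
    AbelianVariety.prodLift (AbelianVariety.fst (X.prod X) B ≫ ψT) (AbelianVariety.snd (X.prod X) B ≫ ψB), e, a,
    ?_, ?_, ha, ha0, ?_⟩
  · rw [AbelianVariety.dim_prod, hT, hB]
  · rw [EisensteinCounterexample.prodLift_sq_eq_neg hψTℕ hψBℕ]; rfl
  · exact_mod_cast hhyp

/-- **The crux on every tenfold `K`-isogenous to a tensor square** (registered sub-goal `stub_tensorIsogenousCrux`):
typing upgrade on `A` (`stub_upgrade`), the tensor-square theorem on `X × X` (every class of its Weil plane is
algebraic), and the proved isogeny descent (`g^* c` lies in the Weil plane of the square, `u^* g^* c = m¹⁰ c`).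
[cite: vanGeemen1994HodgeAV, 3.6–3.7 and proof of Lemma 5.2] [cite: Markman2025SurveySecant, §11.5 Step 1] -/
theorem stub_tensorIsogenousCrux :
    ∀ (A : AbelianVariety ℂ) (φ : A ⟶ A), A.dim = 10 → φ ≫ φ = -((11 : ℤ) • 𝟙 A) →
      ∀ (X : AbelianVariety ℂ) (u : A ⟶ X.prod X) (v : X.prod X ⟶ A) (m : ℕ), X.dim = 5 → 0 < m →
        u ≫ v = m • 𝟙 A → AlgebraicGeometry.Flat u.hom.hom.hom.left →
        v ≫ φ = AbelianVariety.prodLift (AbelianVariety.snd X X ≫ ((-(11 : ℤ)) • 𝟙 X)) (AbelianVariety.fst X X) ≫ v →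
      ∀ c : complexBetti A.X 10, IsRationalClass c → IsOfHodgeType 10 A.X 10 5 5 c →
        c ∈ Module.End.eigenspace (complexBetti.map (𝟙 A + φ).hom.hom.hom 10).hom
              ((1 + Complex.I * (Real.sqrt (11 : ℝ) : ℂ)) ^ 10) ⊔
            Module.End.eigenspace (complexBetti.map (𝟙 A + φ).hom.hom.hom 10).hom
              ((1 - Complex.I * (Real.sqrt (11 : ℝ) : ℂ)) ^ 10) →
        c ∈ algebraicClasses A.X 5 := by
  intro A φ hA hφ X u v m hX hm huv hu hv c hc hcH hW
  have hA' : A.dim = 2 * 5 := hA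
  have hT : (X.prod X).dim = 2 * 5 := by rw [AbelianVariety.dim_prod, hX]
  have hφ' : φ ≫ φ = -(((11 : ℕ) : ℤ) • 𝟙 A) := by exact_mod_cast hφ
  -- the typed plane of `A` lies in its strong Weil plane (landed upgrade)
  have hcW : c ∈ weilClassesOf A φ 5 11 := by
    refine Summit.HodgeConjecture.HodgeConjecture.Theorems.HeckePrymWeilLine.stub_upgrade 11 (by norm_num)
      (by norm_num) (by norm_num) 5 A φ hA' hφ' ?_
    exact_mod_cast hW
  have hAsp : IsSmoothProjective (2 * 5) A.X := isSmoothProjective_of_dim_eq' hA'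
  have hTsp : IsSmoothProjective (2 * 5) (X.prod X).X := isSmoothProjective_of_dim_eq' hT
  obtain ⟨MT⟩ := (nonempty_hodgeModel_holds (n := 2 * 5) (X := (X.prod X).X)).nonempty hTsp
  haveI : AlgebraicGeometry.Flat u.hom.hom.hom.left := hu
  have halg := stub_tensorSquareWeilClassesAlgebraic 5 11 (by norm_num) (by norm_num) X hX
  exact mem_algebraicClasses_of_isogeny_of_mem_weilClassesOf hAsp hTsp MT u v hv hm huv
    (fun c' _ _ hc'W => halg hc'W) hc hcH hcW

end Summit.HodgeConjecture.HodgeConjecture.Theorems.WeilTenfoldsSqrtMinus11.TensorSquare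

end
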